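import Mathlib.Analysis.SpecialFunctions.Integrals.Basic
import Mathlib.Analysis.SumIntegralComparisons
import Mathlib.Data.ZMod.ValMinAbs
import Literature.Probability.LatticeModels.LatticeGraph
import HarnessLib

/-!
# Momentum sums on the space-time torus `(ℤ/L)² × ℤ/M`:
# `|Λ|⁻¹ Σ_{(k,q)} (1 + a·ε(k,q))^{-3} ≤ (1/L + π/(4√a))² (1/M + π/(4√a))`

Topic `Probability/LatticeModels`, namespace `Literature.Probability.LatticeModels`.  The finite-volume
lattice sums that turn the spectral kernel bounds of a finite-range decomposition
(`TorusFormFiniteRangeDecomposition.lean`: `|C_j(x,y)| ≤ |Λ|⁻¹Σ_{(k,q)} G(c₀ε(k,q))` with the cubic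
majorant of `FiniteRangeDecompositionMatrixBounds.lean`) into closed form, uniformly in the
anisotropy `L ≤ M`: with the nearest-neighbour dispersion
`ε(k,q) = Σ_{i=1,2} 2(1 − cos(2πk_i/L)) + 2(1 − cos(2πq/M))` and `a > 0`,

* `one_sub_cos_ge_valMinAbs` — `1 − cos(2πk/n) ≥ 8(|k|_n/n)²` (`|k|_n = |valMinAbs k|`; Jordan's
  inequality, cf. the tree's `SpreadOutIsing.LiuSlade2024Prop24.eight_sq_le_one_sub_cos`), the standard "`λ(k) ≍ |k|²`" on the Brillouin zone (BBS 2019, proof of the `w`-lemma: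
  "Elementary calculus shows that `λ(k) ≍ |k|²`"; Friedli–Velenik 2017, §8.4);
* **`sum_inv_one_add_mul_le`** — the one-dimensional sum
  `Σ_{k ∈ ℤ/n} (1 + a·2(1−cos(2πk/n)))⁻¹ ≤ 1 + πn/(4√a)` (fold `k ↦ |k|_n`, antitone comparison with
  `∫₀^∞ (1+16ax²/n²)⁻¹dx = πn/(8√a)`);
* `inv_cube_le_prod_inv` — `(1 + x + y + z)^{-3} ≤ (1+x)⁻¹(1+y)⁻¹(1+z)⁻¹` for `x,y,z ≥ 0`;
* **`momentumSum_inv_cube_le`** — the displayed bound (the sum factorises over the three coordinates).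

The two regimes of the right side are the `3`-dimensional one (`√a ≲ L`: `≲ a^{-3/2}`) and the
quasi-one-dimensional one of the elongated torus (`√a ≫ L`: `≲ L⁻²(M⁻¹ + a^{-1/2})`).

## References

* R. Bauerschmidt, D. C. Brydges, G. Slade, LNM 2242 (2019), Ch. 3, proof of the `w`-lemma
  ("`∫|k|^{|α|}(1+t²|k|²/M²)^{-s}dk = O((M/t)^{d+|α|})`"). [BauerschmidtBrydgesSlade2019RG]
* S. Friedli, Y. Velenik, *Statistical Mechanics of Lattice Systems* (CUP 2017), §8.4, §B.
  [FriedliVelenik2017]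
-/

noncomputable section

open Finset MeasureTheory Set intervalIntegral
open scoped Real

namespace Literature.Probability.LatticeModels

/-! ### `1 − cos(2πk/n) ≥ 8(|k|_n/n)²` -/

/-- `cos(2π k.val/n) = cos(2π valMinAbs(k)/n)` (the two representatives differ by `n`). [folklore] -/
theorem cos_two_pi_val_eq_cos_valMinAbs (n : ℕ) [NeZero n] (k : ZMod n) :
    Real.cos (2 * π * (k.val : ℝ) / n) = Real.cos (2 * π * (k.valMinAbs : ℝ) / n) := by
  have hn : (n : ℝ) ≠ 0 := by exact_mod_cast NeZero.ne n
  rw [ZMod.valMinAbs_def_pos]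
  split_ifs with h
  · push_cast; rfl
  · push_cast
    rw [show 2 * π * ((k.val : ℝ) - n) / n = 2 * π * (k.val : ℝ) / n - 2 * π by field_simp,
      Real.cos_sub_two_pi]

/-- **`λ(k) ≍ |k|²` on the Brillouin zone, lower bound**: `8(|k|_n/n)² ≤ 1 − cos(2πk/n)` with
`|k|_n = |valMinAbs k| ≤ n/2`. [cite: BauerschmidtBrydgesSlade2019RG, Ch. 3, proof of the w-lemma ("λ(k) ≍ |k|²")] -/
theorem one_sub_cos_ge_valMinAbs (n : ℕ) [NeZero n] (k : ZMod n) :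
    8 * ((k.valMinAbs.natAbs : ℝ) / n) ^ 2 ≤ 1 - Real.cos (2 * π * (k.val : ℝ) / n) := by
  have hn : (0 : ℝ) < n := by exact_mod_cast Nat.pos_of_ne_zero (NeZero.ne n)
  rw [cos_two_pi_val_eq_cos_valMinAbs, show 2 * π * (k.valMinAbs : ℝ) / n = 2 * π * ((k.valMinAbs : ℝ) / n)
    by ring]
  have habs2 : (k.valMinAbs.natAbs : ℝ) = |(k.valMinAbs : ℝ)| := by
    rw [← Int.cast_natCast, Int.natCast_natAbs, Int.cast_abs]
  have habs : ((k.valMinAbs.natAbs : ℝ) / n) ^ 2 = ((k.valMinAbs : ℝ) / n) ^ 2 := by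
    rw [habs2, div_pow, div_pow, sq_abs]
  rw [habs]
  -- Jordan's inequality: `8s² ≤ 1 − cos(2πs)` for `|s| ≤ ½` (as in the tree's
  -- `SpreadOutIsing.LiuSlade2024Prop24.eight_sq_le_one_sub_cos`, reproved here to avoid the import)
  have jordan : ∀ {s : ℝ}, |s| ≤ 1 / 2 → 8 * s ^ 2 ≤ 1 - Real.cos (2 * π * s) := by
    have hsin : ∀ {u : ℝ}, |u| ≤ 1 / 2 → 0 ≤ u → 8 * u ^ 2 ≤ 1 - Real.cos (2 * π * u) := by
      intro u hu hu0
      have hle : u ≤ 1 / 2 := (le_abs_self u).trans hu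
      have hx : 2 / π * (π * u) ≤ Real.sin (π * u) :=
        Real.mul_le_sin (by positivity) (by nlinarith [Real.pi_pos])
      have h2 : 2 / π * (π * u) = 2 * u := by field_simp
      rw [h2] at hx
      have hcos : Real.cos (2 * π * u) = 1 - 2 * Real.sin (π * u) ^ 2 := by
        rw [show 2 * π * u = 2 * (π * u) by ring, Real.cos_two_mul, Real.sin_sq]
        ring
      rw [hcos]
      have h0 : 0 ≤ 2 * u := by linarith
      nlinarith [mul_self_le_mul_self h0 hx]
    intro s hs
    rcases le_total 0 s with h | h
    · exact hsin hs h
    · have := hsin (u := -s) (by rwa [abs_neg]) (by linarith)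
      rwa [even_two.neg_pow, mul_neg, Real.cos_neg] at this
  apply jordan
  rw [abs_div, abs_of_pos hn, div_le_iff₀ hn, ← habs2]
  have h := ZMod.natAbs_valMinAbs_le k
  have h' : (k.valMinAbs.natAbs : ℝ) ≤ (n : ℝ) / 2 := by
    have : (k.valMinAbs.natAbs : ℝ) ≤ ((n / 2 : ℕ) : ℝ) := by exact_mod_cast h
    exact this.trans (Nat.cast_div_le)
  linarith

/-! ### The one-dimensional sum -/

/-- `∫₀^N (1 + c x²)⁻¹ dx ≤ π/(2√c)` for `c > 0`. [folklore] -/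
theorem integral_inv_one_add_mul_sq_le {c : ℝ} (hc : 0 < c) (N : ℝ) :
    ∫ x in (0:ℝ)..N, (1 + c * x ^ 2)⁻¹ ≤ π / (2 * Real.sqrt c) := by
  have hs : 0 < Real.sqrt c := Real.sqrt_pos.mpr hc
  have hsq : Real.sqrt c ^ 2 = c := Real.sq_sqrt hc.le
  have hsub : ∫ x in (0:ℝ)..N, (1 + c * x ^ 2)⁻¹ =
      (Real.sqrt c)⁻¹ * ∫ y in (0:ℝ)..(Real.sqrt c * N), (1 + y ^ 2)⁻¹ := by
    have := intervalIntegral.integral_comp_mul_left (fun y : ℝ => (1 + y ^ 2)⁻¹)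
      (a := 0) (b := N) hs.ne'
    -- `∫₀^N f(√c x) dx = (√c)⁻¹ ∫₀^{√c N} f`
    rw [mul_zero, smul_eq_mul] at this
    rw [← this]
    refine intervalIntegral.integral_congr fun x _ => ?_
    show (1 + c * x ^ 2)⁻¹ = (1 + (Real.sqrt c * x) ^ 2)⁻¹
    rw [mul_pow, hsq]
  rw [hsub]
  have hint : ∫ y in (0:ℝ)..(Real.sqrt c * N), (1 + y ^ 2)⁻¹ ≤ π / 2 := by
    simp_rw [← one_div]
    rw [integral_one_div_one_add_sq, Real.arctan_zero, sub_zero]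
    exact (Real.arctan_lt_pi_div_two _).le
  calc (Real.sqrt c)⁻¹ * ∫ y in (0:ℝ)..(Real.sqrt c * N), (1 + y ^ 2)⁻¹
      ≤ (Real.sqrt c)⁻¹ * (π / 2) := mul_le_mul_of_nonneg_left hint (by positivity)
    _ = π / (2 * Real.sqrt c) := by field_simp

/-- Antitone comparison: `Σ_{j=1}^{N} (1 + c j²)⁻¹ ≤ ∫₀^N (1 + c x²)⁻¹ dx` for `c ≥ 0`. [folklore] -/
theorem sum_inv_one_add_mul_sq_le_integral {c : ℝ} (hc : 0 ≤ c) (N : ℕ) :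
    ∑ j ∈ Finset.Icc 1 N, (1 + c * (j : ℝ) ^ 2)⁻¹ ≤ ∫ x in (0:ℝ)..N, (1 + c * x ^ 2)⁻¹ := by
  have hanti : AntitoneOn (fun x : ℝ => (1 + c * x ^ 2)⁻¹) (Set.Icc ((0:ℕ):ℝ) ((N:ℕ):ℝ)) := by
    intro x hx y _ hxy
    have hx0 : 0 ≤ x := by simpa using hx.1
    apply inv_anti₀ (by positivity)
    have : x ^ 2 ≤ y ^ 2 := pow_le_pow_left₀ hx0 hxy 2
    nlinarith
  have h := AntitoneOn.sum_le_integral_Ico (Nat.zero_le N) hanti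
  simp only [Nat.cast_zero] at h
  convert h using 1
  -- `Σ_{j ∈ Icc 1 N} f j = Σ_{i ∈ Ico 0 N} f (i+1)`
  have hI : Finset.Icc 1 N = (Finset.Ico 0 N).map (addRightEmbedding 1) := by
    rw [Finset.map_add_right_Ico, zero_add, Finset.Ico_add_one_right_eq_Icc]
  rw [hI, Finset.sum_map]
  rfl

/-- Folding `k ↦ |k|_n`: for `g ≥ 0` antitone in `|k|_n`, the sum over `ℤ/n` is at most
`g(0) + 2Σ_{j=1}^{n/2} g(j)`. [folklore] -/
theorem sum_zmod_le_of_valMinAbs (n : ℕ) [NeZero n] (g : ℕ → ℝ) (hg : ∀ j, 0 ≤ g j) :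
    ∑ k : ZMod n, g k.valMinAbs.natAbs ≤ g 0 + 2 * ∑ j ∈ Finset.Icc 1 (n / 2), g j := by
  classical
  -- sum over the injective image of `valMinAbs`
  have hinj : Function.Injective (ZMod.valMinAbs : ZMod n → ℤ) := ZMod.injective_valMinAbs
  have h1 : ∑ k : ZMod n, g k.valMinAbs.natAbs =
      ∑ m ∈ (Finset.univ : Finset (ZMod n)).image ZMod.valMinAbs, g m.natAbs := by
    rw [Finset.sum_image (fun x _ y _ h => hinj h)]
  have hsub : (Finset.univ : Finset (ZMod n)).image ZMod.valMinAbs ⊆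
      Finset.Icc (-(n / 2 : ℕ) : ℤ) (n / 2 : ℕ) := by
    intro m hm
    obtain ⟨k, -, rfl⟩ := Finset.mem_image.mp hm
    have h := ZMod.natAbs_valMinAbs_le k
    rw [Finset.mem_Icc]
    constructor <;> omega
  have h2 : ∑ m ∈ (Finset.univ : Finset (ZMod n)).image ZMod.valMinAbs, g m.natAbs ≤
      ∑ m ∈ Finset.Icc (-(n / 2 : ℕ) : ℤ) (n / 2 : ℕ), g m.natAbs :=
    Finset.sum_le_sum_of_subset_of_nonneg hsub fun m _ _ => hg _
  -- symmetric sum over `[-N, N]`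
  have h3 : ∀ N : ℕ, ∑ m ∈ Finset.Icc (-(N : ℤ)) N, g m.natAbs = g 0 + 2 * ∑ j ∈ Finset.Icc 1 N, g j := by
    intro N
    induction N with
    | zero => simp
    | succ N ih =>
        have hdecomp : Finset.Icc (-((N + 1 : ℕ) : ℤ)) ((N + 1 : ℕ) : ℤ) =
            insert (-((N + 1 : ℕ) : ℤ)) (insert ((N + 1 : ℕ) : ℤ) (Finset.Icc (-(N : ℤ)) N)) := by
          ext m
          simp only [Finset.mem_Icc, Finset.mem_insert]
          omega
        rw [hdecomp, Finset.sum_insert, Finset.sum_insert, ih, Finset.sum_Icc_succ_top (by omega)]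
        · have e1 : ((-((N + 1 : ℕ) : ℤ)).natAbs) = N + 1 := by omega
          have e2 : (((N + 1 : ℕ) : ℤ)).natAbs = N + 1 := by omega
          rw [e1, e2]
          ring
        · simp only [Finset.mem_Icc]; omega
        · simp only [Finset.mem_insert, Finset.mem_Icc]; omega
  rw [h1]
  exact h2.trans (le_of_eq (h3 _))

/-- **The one-dimensional momentum sum**: for `a > 0` and `n ≥ 1`,
`Σ_{k ∈ ℤ/n} (1 + a·2(1 − cos(2πk/n)))⁻¹ ≤ 1 + πn/(4√a)`.
[cite: BauerschmidtBrydgesSlade2019RG, Ch. 3, proof of the w-lemma (the k-integral ∫(1+t²|k|²/M²)^{-s}dk)] -/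
theorem sum_inv_one_add_mul_le (n : ℕ) [NeZero n] {a : ℝ} (ha : 0 < a) :
    ∑ k : ZMod n, (1 + a * (2 * (1 - Real.cos (2 * π * (k.val : ℝ) / n))))⁻¹ ≤
      1 + π * n / (4 * Real.sqrt a) := by
  have hn : (0 : ℝ) < n := by exact_mod_cast Nat.pos_of_ne_zero (NeZero.ne n)
  set c : ℝ := 16 * a / (n : ℝ) ^ 2 with hc
  have hc0 : 0 < c := by positivity
  set g : ℕ → ℝ := fun j => (1 + c * (j : ℝ) ^ 2)⁻¹ with hg
  have hg0 : ∀ j, 0 ≤ g j := fun j => by positivity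
  -- termwise comparison with `g(|k|_n)`
  have hterm : ∀ k : ZMod n, (1 + a * (2 * (1 - Real.cos (2 * π * (k.val : ℝ) / n))))⁻¹ ≤
      g k.valMinAbs.natAbs := by
    intro k
    have h := one_sub_cos_ge_valMinAbs n k
    simp only [hg]
    apply inv_anti₀ (by positivity)
    have : c * (k.valMinAbs.natAbs : ℝ) ^ 2 = a * (2 * (8 * ((k.valMinAbs.natAbs : ℝ) / n) ^ 2)) := by
      rw [hc]; field_simp; ring
    rw [this]
    nlinarith [ha.le]
  calc ∑ k : ZMod n, (1 + a * (2 * (1 - Real.cos (2 * π * (k.val : ℝ) / n))))⁻¹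
      ≤ ∑ k : ZMod n, g k.valMinAbs.natAbs := Finset.sum_le_sum fun k _ => hterm k
    _ ≤ g 0 + 2 * ∑ j ∈ Finset.Icc 1 (n / 2), g j := sum_zmod_le_of_valMinAbs n g hg0
    _ ≤ 1 + 2 * (π / (2 * Real.sqrt c)) := by
        have hg00 : g 0 = 1 := by simp [hg]
        rw [hg00]
        have := (sum_inv_one_add_mul_sq_le_integral hc0.le (n / 2)).trans
          (integral_inv_one_add_mul_sq_le hc0 _)
        linarith
    _ = 1 + π * n / (4 * Real.sqrt a) := by
        have hsc : Real.sqrt c = 4 * Real.sqrt a / n := by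
          rw [hc, show 16 * a / (n : ℝ) ^ 2 = (4 * Real.sqrt a / n) ^ 2 by
            rw [div_pow, mul_pow, Real.sq_sqrt ha.le]; norm_num]
          exact Real.sqrt_sq (by positivity)
        rw [hsc]
        field_simp

/-! ### The three-dimensional sum -/

/-- `(1 + x + y + z)^{-3} ≤ (1+x)⁻¹(1+y)⁻¹(1+z)⁻¹` for `x, y, z ≥ 0`. [folklore] -/
theorem inv_cube_le_prod_inv {x y z : ℝ} (hx : 0 ≤ x) (hy : 0 ≤ y) (hz : 0 ≤ z) :
    ((1 + x + y + z) ^ 3)⁻¹ ≤ (1 + x)⁻¹ * (1 + y)⁻¹ * (1 + z)⁻¹ := by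
  rw [← mul_inv, ← mul_inv]
  apply inv_anti₀ (by positivity)
  have hs : 0 ≤ x + y + z := by linarith
  have hxyz : x * y * z ≤ (x + y + z) * (x + y + z) * (x + y + z) := by
    apply mul_le_mul _ (by linarith) hz (mul_nonneg hs hs)
    exact mul_le_mul (by linarith) (by linarith) hy hs
  have hpair : x * y + y * z + x * z ≤ (x + y + z) * (x + y + z) := by
    nlinarith [mul_nonneg hx hy, mul_nonneg hy hz, mul_nonneg hx hz, sq_nonneg x, sq_nonneg y, sq_nonneg z]
  nlinarith [mul_nonneg hx hy, mul_nonneg hy hz, mul_nonneg hx hz, hxyz, hpair]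

/-- **The momentum sum on `(ℤ/L)² × ℤ/M`**: for `a > 0`,
`Σ_{(k,q)} (1 + a·ε(k,q))^{-3} ≤ (1 + πL/(4√a))²·(1 + πM/(4√a))` with
`ε(k,q) = Σ_{i=1,2} 2(1−cos(2πk_i/L)) + 2(1−cos(2πq/M))`; dividing by `|Λ| = L²M` gives
`|Λ|⁻¹Σ ≤ (1/L + π/(4√a))²(1/M + π/(4√a))`.
[cite: BauerschmidtBrydgesSlade2019RG, Ch. 3, proof of the w-lemma and of (3.11)] -/
theorem momentumSum_inv_cube_le (L M : ℕ) [NeZero L] [NeZero M] {a : ℝ} (ha : 0 < a) :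
    ∑ kq : TorusSite 2 L × ZMod M,
        ((1 + a * ((∑ i, 2 * (1 - Real.cos (2 * π * ((kq.1 i).val : ℝ) / L))) +
          2 * (1 - Real.cos (2 * π * ((kq.2).val : ℝ) / M)))) ^ 3)⁻¹ ≤
      (1 + π * L / (4 * Real.sqrt a)) ^ 2 * (1 + π * M / (4 * Real.sqrt a)) := by
  set f : ZMod L → ℝ := fun k => (1 + a * (2 * (1 - Real.cos (2 * π * (k.val : ℝ) / L))))⁻¹ with hf
  set h : ZMod M → ℝ := fun q => (1 + a * (2 * (1 - Real.cos (2 * π * (q.val : ℝ) / M))))⁻¹ with hh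
  have hcos : ∀ (m : ℕ) (k : ZMod m), 0 ≤ 2 * (1 - Real.cos (2 * π * (k.val : ℝ) / m)) :=
    fun m k => by nlinarith [Real.cos_le_one (2 * π * (k.val : ℝ) / m)]
  -- termwise: `(1 + a(ε₁+ε₂+ε₃))^{-3} ≤ f(k₀) f(k₁) h(q)`
  have hterm : ∀ kq : TorusSite 2 L × ZMod M,
      ((1 + a * ((∑ i, 2 * (1 - Real.cos (2 * π * ((kq.1 i).val : ℝ) / L))) +
          2 * (1 - Real.cos (2 * π * ((kq.2).val : ℝ) / M)))) ^ 3)⁻¹ ≤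
        f (kq.1 0) * f (kq.1 1) * h kq.2 := by
    intro kq
    rw [Fin.sum_univ_two]
    have e : 1 + a * (2 * (1 - Real.cos (2 * π * ((kq.1 0).val : ℝ) / L)) +
          2 * (1 - Real.cos (2 * π * ((kq.1 1).val : ℝ) / L)) +
          2 * (1 - Real.cos (2 * π * ((kq.2).val : ℝ) / M))) =
        1 + a * (2 * (1 - Real.cos (2 * π * ((kq.1 0).val : ℝ) / L))) +
          a * (2 * (1 - Real.cos (2 * π * ((kq.1 1).val : ℝ) / L))) +
          a * (2 * (1 - Real.cos (2 * π * ((kq.2).val : ℝ) / M))) := by ring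
    rw [e]
    exact inv_cube_le_prod_inv (mul_nonneg ha.le (hcos _ _)) (mul_nonneg ha.le (hcos _ _))
      (mul_nonneg ha.le (hcos _ _))
  -- the factorised sum
  have hsum : ∑ kq : TorusSite 2 L × ZMod M, f (kq.1 0) * f (kq.1 1) * h kq.2 =
      (∑ k : ZMod L, f k) ^ 2 * ∑ q : ZMod M, h q := by
    rw [Fintype.sum_prod_type]
    simp_rw [← Finset.mul_sum]
    rw [← Finset.sum_mul]
    congr 1
    -- `Σ_{k : Fin 2 → ZMod L} f(k 0) f(k 1) = (Σ f)²`
    have : ∑ k : TorusSite 2 L, f (k 0) * f (k 1) = ∑ k : TorusSite 2 L, ∏ i : Fin 2, f (k i) := by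
      refine Finset.sum_congr rfl fun k _ => ?_
      rw [Fin.prod_univ_two]
    rw [this, ← Fintype.piFinset_univ, ← Finset.prod_univ_sum, Fin.prod_univ_two, sq]
  have hfL := sum_inv_one_add_mul_le L ha
  have hhM := sum_inv_one_add_mul_le M ha
  have hf0 : 0 ≤ ∑ k : ZMod L, f k := Finset.sum_nonneg fun k _ => by
    simp only [hf]
    exact inv_nonneg.mpr (by nlinarith [hcos L k, ha.le])
  have hh0 : 0 ≤ ∑ q : ZMod M, h q := Finset.sum_nonneg fun q _ => by
    simp only [hh]
    exact inv_nonneg.mpr (by nlinarith [hcos M q, ha.le])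
  calc _ ≤ ∑ kq : TorusSite 2 L × ZMod M, f (kq.1 0) * f (kq.1 1) * h kq.2 :=
        Finset.sum_le_sum fun kq _ => hterm kq
    _ = (∑ k : ZMod L, f k) ^ 2 * ∑ q : ZMod M, h q := hsum
    _ ≤ (1 + π * L / (4 * Real.sqrt a)) ^ 2 * (1 + π * M / (4 * Real.sqrt a)) := by
        apply mul_le_mul (pow_le_pow_left₀ hf0 hfL 2) hhM hh0 (by positivity)

end Literature.Probability.LatticeModels

end
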